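import Mathlib
import Summits.Ventures.HodgeRepro.Statements
import Summits.Ventures.HodgeRepro.BallGenSylvester

/-!
# The two tori of a seesaw datum (seat p2, gen 7)

The docstring of the sealed statement (b) reads a `SeesawDatum` as «the seesaw dual pairs `U(W_i) × U(V) ⊂ U(W) × U(V)`»
and the route (ROUTE.md §4 item 2, closer C7) needs «two toric periods … for two DIFFERENT tori».  On the kernel, over the
CM field `L` itself (`star = complexConj`, Mathlib's `IsCMField.starRing`), in typer-2's vocabulary `unitaryGroupOf H =
{g ∈ GL₂(L) : gᴴ H g = H}`:

* `diagTorus L ≤ GL (Fin 2) L` — the diagonal matrices `diag(x, y)` with `x, y ∈ U(1)(L) = {z : z̄ z = 1}`, i.e.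
  `U(W₀) × U(W₁)` in the basis of the two lines;
* `diagTorus_le_unitaryGroupOf` — for REAL `a, b` the torus lies in `U(diag(a, b))` = the unitary group of the plane
  `W₀ ⊕ W₁`;
* `conj_mem_unitaryGroupOf` — an isometry `gᴴ D₀ g = D₂` carries `U(D₂)` into `U(D₀)` by conjugation;
* **`exists_two_tori`** — every seesaw datum `S` gives two tori in `U(W₀ ⊕ W₁)`: the diagonal torus `T` (the lines
  `W₀, W₁`) and `g T g⁻¹` (the lines `W₂, W₃`, transported by the isometry `g` of `S.iso`).

Nothing here says anything about the status of the Hodge conjecture for CM abelian varieties.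
-/

set_option autoImplicit false

noncomputable section

namespace Summit.Ventures.HodgeRepro

open Matrix NumberField MuTable
open HodgeRepro.BallGen (unitaryGroupOf mem_unitaryGroupOf)

namespace MuTableTori

variable (L : Type) [Field L] [NumberField L] [NumberField.IsCMField L]

/-- The diagonal matrix `diag(x, y)` of two unitary elements, as an element of `GL₂(L)` (inverse `diag(x̄, ȳ)`). -/
def diagUnit (x y : unitary L) : GL (Fin 2) L where
  val := diagonal ![(x : L), (y : L)]
  inv := diagonal ![star (x : L), star (y : L)]
  val_inv := by
    rw [diagonal_mul_diagonal]
    ext i j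
    fin_cases i <;> fin_cases j <;> simp [diagonal]
  inv_val := by
    rw [diagonal_mul_diagonal]
    ext i j
    fin_cases i <;> fin_cases j <;> simp [diagonal]

/-- The matrix of `diagUnit x y`. -/
@[simp] theorem diagUnit_val (x y : unitary L) :
    ((diagUnit L x y : GL (Fin 2) L) : Matrix (Fin 2) (Fin 2) L) = diagonal ![(x : L), (y : L)] := rfl

/-- `(x, y) ↦ diag(x, y)` is a homomorphism `U(1) × U(1) → GL₂(L)`. -/
def diagHom : unitary L × unitary L →* GL (Fin 2) L where
  toFun p := diagUnit L p.1 p.2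
  map_one' := by
    apply Units.ext
    simp only [diagUnit_val, Prod.fst_one, Prod.snd_one, Units.val_one]
    ext i j
    fin_cases i <;> fin_cases j <;> simp [diagonal, one_apply]
  map_mul' p q := by
    apply Units.ext
    simp only [diagUnit_val, Prod.fst_mul, Prod.snd_mul, Units.val_mul, diagonal_mul_diagonal]
    congr 1
    funext i
    fin_cases i <;> simp

/-- **The diagonal torus** `T = U(W₀) × U(W₁) ≤ GL₂(L)`: the diagonal matrices with unitary entries. -/
def diagTorus : Subgroup (GL (Fin 2) L) := (diagHom L).range

/-- Membership in the diagonal torus. -/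
theorem mem_diagTorus_iff (g : GL (Fin 2) L) :
    g ∈ diagTorus L ↔ ∃ x y : unitary L, (g : Matrix (Fin 2) (Fin 2) L) = diagonal ![(x : L), (y : L)] := by
  constructor
  · rintro ⟨⟨x, y⟩, rfl⟩
    exact ⟨x, y, rfl⟩
  · rintro ⟨x, y, h⟩
    exact ⟨(x, y), Units.ext h.symm⟩

variable {L}

/-- The diagonal torus lies in `U(diag(a, b))` for every diagonal form — in particular in the unitary group of the plane
`W₀ ⊕ W₁ = (L, a x ȳ) ⊕ (L, b x ȳ)` of a seesaw datum. -/
theorem diagTorus_le_unitaryGroupOf (a b : L) :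
    diagTorus L ≤ unitaryGroupOf (diagonal ![a, b]) := by
  rintro g ⟨⟨x, y⟩, rfl⟩
  rw [mem_unitaryGroupOf]
  show (diagonal ![(x : L), (y : L)])ᴴ * diagonal ![a, b] * diagonal ![(x : L), (y : L)] = diagonal ![a, b]
  rw [diagonal_conjTranspose, diagonal_mul_diagonal, diagonal_mul_diagonal]
  congr 1
  funext i
  fin_cases i
  · simp only [Pi.star_apply, Fin.zero_eta, Fin.isValue, cons_val_zero]
    calc star (x : L) * a * x = a * (star (x : L) * x) := by ring
      _ = a := by rw [Unitary.coe_star_mul_self, mul_one]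
  · simp only [Pi.star_apply, Fin.mk_one, Fin.isValue, cons_val_one, cons_val_fin_one]
    calc star (y : L) * b * y = b * (star (y : L) * y) := by ring
      _ = b := by rw [Unitary.coe_star_mul_self, mul_one]

/-- An isometry `gᴴ D₀ g = D₂` expresses `D₀` through `D₂`: `D₀ = (g⁻¹)ᴴ D₂ g⁻¹`. -/
theorem eq_of_isometry {D₀ D₂ : Matrix (Fin 2) (Fin 2) L} {g : GL (Fin 2) L}
    (hg : (g : Matrix (Fin 2) (Fin 2) L)ᴴ * D₀ * (g : Matrix (Fin 2) (Fin 2) L) = D₂) :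
    D₀ = ((g⁻¹ : GL (Fin 2) L) : Matrix (Fin 2) (Fin 2) L)ᴴ * D₂ * ((g⁻¹ : GL (Fin 2) L) : Matrix (Fin 2) (Fin 2) L) := by
  set Gm : Matrix (Fin 2) (Fin 2) L := (g : Matrix (Fin 2) (Fin 2) L) with hGm
  set Gi : Matrix (Fin 2) (Fin 2) L := ((g⁻¹ : GL (Fin 2) L) : Matrix (Fin 2) (Fin 2) L) with hGi
  have h1 : Gm * Gi = 1 := by rw [hGm, hGi, ← Units.val_mul, mul_inv_cancel, Units.val_one]
  rw [← hg]
  calc D₀ = (Gm * Gi)ᴴ * D₀ * (Gm * Gi) := by rw [h1, conjTranspose_one, Matrix.one_mul, Matrix.mul_one]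
    _ = Giᴴ * (Gmᴴ * D₀ * Gm) * Gi := by simp only [conjTranspose_mul, Matrix.mul_assoc]

/-- An isometry `gᴴ D₀ g = D₂` carries `U(D₂)` into `U(D₀)`: `h ∈ U(D₂) → g h g⁻¹ ∈ U(D₀)`. -/
theorem conj_mem_unitaryGroupOf {D₀ D₂ : Matrix (Fin 2) (Fin 2) L} {g : GL (Fin 2) L}
    (hg : (g : Matrix (Fin 2) (Fin 2) L)ᴴ * D₀ * (g : Matrix (Fin 2) (Fin 2) L) = D₂)
    {h : GL (Fin 2) L} (hh : h ∈ unitaryGroupOf D₂) : g * h * g⁻¹ ∈ unitaryGroupOf D₀ := by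
  rw [mem_unitaryGroupOf] at hh ⊢
  set Gm : Matrix (Fin 2) (Fin 2) L := (g : Matrix (Fin 2) (Fin 2) L) with hGm
  set Gi : Matrix (Fin 2) (Fin 2) L := ((g⁻¹ : GL (Fin 2) L) : Matrix (Fin 2) (Fin 2) L) with hGi
  set Hm : Matrix (Fin 2) (Fin 2) L := (h : Matrix (Fin 2) (Fin 2) L) with hHm
  have hval : ((g * h * g⁻¹ : GL (Fin 2) L) : Matrix (Fin 2) (Fin 2) L) = Gm * Hm * Gi := by
    simp only [Units.val_mul, hGm, hHm, hGi]
  rw [hval]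
  have hD : D₀ = Giᴴ * D₂ * Gi := eq_of_isometry hg
  calc (Gm * Hm * Gi)ᴴ * D₀ * (Gm * Hm * Gi)
      = Giᴴ * (Hmᴴ * (Gmᴴ * D₀ * Gm) * Hm) * Gi := by simp only [conjTranspose_mul, Matrix.mul_assoc]
    _ = Giᴴ * (Hmᴴ * D₂ * Hm) * Gi := by rw [hg]
    _ = Giᴴ * D₂ * Gi := by rw [hh]
    _ = D₀ := hD.symm

/-- The transported torus `g T g⁻¹`. -/
theorem map_conj_le_unitaryGroupOf {D₀ D₂ : Matrix (Fin 2) (Fin 2) L} {g : GL (Fin 2) L}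
    (hg : (g : Matrix (Fin 2) (Fin 2) L)ᴴ * D₀ * (g : Matrix (Fin 2) (Fin 2) L) = D₂)
    {T : Subgroup (GL (Fin 2) L)} (hT : T ≤ unitaryGroupOf D₂) :
    T.map (MulAut.conj g).toMonoidHom ≤ unitaryGroupOf D₀ := by
  rintro k ⟨h, hh, rfl⟩
  exact conj_mem_unitaryGroupOf hg (hT hh)

/-- Two isometries `g₁, g₂` with `gᴴ D₀ g = D₂` differ by an element of `U(D₀)`: `g₁ g₂⁻¹ ∈ U(D₀)`. -/
theorem isometry_div_mem_unitaryGroupOf {D₀ D₂ : Matrix (Fin 2) (Fin 2) L} {g₁ g₂ : GL (Fin 2) L}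
    (h₁ : (g₁ : Matrix (Fin 2) (Fin 2) L)ᴴ * D₀ * (g₁ : Matrix (Fin 2) (Fin 2) L) = D₂)
    (h₂ : (g₂ : Matrix (Fin 2) (Fin 2) L)ᴴ * D₀ * (g₂ : Matrix (Fin 2) (Fin 2) L) = D₂) :
    g₁ * g₂⁻¹ ∈ unitaryGroupOf D₀ := by
  rw [mem_unitaryGroupOf]
  set G₁ : Matrix (Fin 2) (Fin 2) L := (g₁ : Matrix (Fin 2) (Fin 2) L) with hG₁
  set G₂ : Matrix (Fin 2) (Fin 2) L := ((g₂⁻¹ : GL (Fin 2) L) : Matrix (Fin 2) (Fin 2) L) with hG₂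
  have hval : ((g₁ * g₂⁻¹ : GL (Fin 2) L) : Matrix (Fin 2) (Fin 2) L) = G₁ * G₂ := by
    simp only [Units.val_mul, hG₁, hG₂]
  rw [hval]
  have hD : D₀ = G₂ᴴ * D₂ * G₂ := eq_of_isometry h₂
  calc (G₁ * G₂)ᴴ * D₀ * (G₁ * G₂) = G₂ᴴ * (G₁ᴴ * D₀ * G₁) * G₂ := by
        simp only [conjTranspose_mul, Matrix.mul_assoc]
    _ = G₂ᴴ * D₂ * G₂ := by rw [h₁]
    _ = D₀ := hD.symm

omit [NumberField L] [NumberField.IsCMField L] in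
/-- **The transported torus is canonical up to `U(D₀)`**: for two isometries `g₁, g₂`, the tori `g₁ T g₁⁻¹` and
`g₂ T g₂⁻¹` are conjugate by `h = g₁ g₂⁻¹ ∈ U(D₀)` (so the choice of `g` in `S.iso` is immaterial inside `U(W)`). -/
theorem map_conj_eq_map_conj_map {g₁ g₂ : GL (Fin 2) L} (T : Subgroup (GL (Fin 2) L)) :
    T.map (MulAut.conj g₁).toMonoidHom =
      (T.map (MulAut.conj g₂).toMonoidHom).map (MulAut.conj (g₁ * g₂⁻¹)).toMonoidHom := by
  rw [Subgroup.map_map]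
  congr 1
  ext k
  simp [mul_assoc]

/-- The Gram matrix of the plane `W₀ ⊕ W₁` of a seesaw datum. -/
def gram (S : SeesawDatum L) : Matrix (Fin 2) (Fin 2) L := diagonal ![S.a 0, S.a 1]

/-- The Gram matrix of the plane `W₂ ⊕ W₃`. -/
def gram' (S : SeesawDatum L) : Matrix (Fin 2) (Fin 2) L := diagonal ![S.a 2, S.a 3]

/-- The sealed isometry `S.iso` in `conjTranspose` form: `gᴴ · gram S · g = gram' S` (`star = complexConj`). -/
theorem exists_isometry (S : SeesawDatum L) :
    ∃ g : GL (Fin 2) L, (g : Matrix (Fin 2) (Fin 2) L)ᴴ * gram S * (g : Matrix (Fin 2) (Fin 2) L) = gram' S := by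
  obtain ⟨g, hg⟩ := S.iso
  exact ⟨g, hg⟩

/-- The diagonal torus lies in `U(W₀ ⊕ W₁)`. -/
theorem diagTorus_le_gram (S : SeesawDatum L) : diagTorus L ≤ unitaryGroupOf (gram S) :=
  diagTorus_le_unitaryGroupOf (S.a 0) (S.a 1)

/-- The diagonal torus lies in `U(W₂ ⊕ W₃)`. -/
theorem diagTorus_le_gram' (S : SeesawDatum L) : diagTorus L ≤ unitaryGroupOf (gram' S) :=
  diagTorus_le_unitaryGroupOf (S.a 2) (S.a 3)

/-- **Two tori in `U(W₀ ⊕ W₁)` for every seesaw datum**: the diagonal torus `T` (the lines `W₀, W₁`) and its transport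
`g T g⁻¹` along the isometry `g` of `S.iso` (the lines `W₂, W₃` read in the first basis). -/
theorem exists_two_tori (S : SeesawDatum L) :
    diagTorus L ≤ unitaryGroupOf (gram S) ∧
      ∃ g : GL (Fin 2) L, (g : Matrix (Fin 2) (Fin 2) L)ᴴ * gram S * (g : Matrix (Fin 2) (Fin 2) L) = gram' S ∧
        (diagTorus L).map (MulAut.conj g).toMonoidHom ≤ unitaryGroupOf (gram S) := by
  refine ⟨diagTorus_le_gram S, ?_⟩
  obtain ⟨g, hg⟩ := exists_isometry S
  exact ⟨g, hg, map_conj_le_unitaryGroupOf hg (diagTorus_le_gram' S)⟩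

/-! ### A seesaw datum whose two tori are DIFFERENT -/

section Sum

variable {L : Type} [Field L] [NumberField L] [NumberField.IsCMField L]

/-- The isometry matrix `[[1, a₁], [1, −a₀]]` (columns `(1, 1)` and `(a₁, −a₀)`, orthogonal for `diag(a₀, a₁)`). -/
def sumMat (a₀ a₁ : L) : Matrix (Fin 2) (Fin 2) L := !![1, a₁; 1, -a₀]

omit [NumberField L] [NumberField.IsCMField L] in
/-- `det [[1, a₁], [1, −a₀]] = −(a₀ + a₁)`. -/
theorem det_sumMat (a₀ a₁ : L) : (sumMat a₀ a₁).det = -(a₀ + a₁) := by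
  rw [sumMat, Matrix.det_fin_two_of]; ring

/-- The isometry as an element of `GL₂(L)` (`a₀ + a₁ ≠ 0`). -/
def sumGL (a₀ a₁ : L) (hs : a₀ + a₁ ≠ 0) : GL (Fin 2) L :=
  ((Matrix.isUnit_iff_isUnit_det (sumMat a₀ a₁)).2
    (isUnit_iff_ne_zero.2 (by rw [det_sumMat]; exact neg_ne_zero.2 hs))).unit

omit [NumberField L] [NumberField.IsCMField L] in
/-- The matrix of `sumGL`. -/
@[simp] theorem sumGL_val (a₀ a₁ : L) (hs : a₀ + a₁ ≠ 0) :
    ((sumGL a₀ a₁ hs : GL (Fin 2) L) : Matrix (Fin 2) (Fin 2) L) = sumMat a₀ a₁ := IsUnit.unit_spec _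

/-- **The sum datum** `(a₀, a₁, a₀ + a₁, a₀ a₁ (a₀ + a₁))`: the plane `W₀ ⊕ W₁` re-decomposed along the vector `(1, 1)`
and its orthogonal `(a₁, −a₀)` — a seesaw datum whose isometry is NOT a permutation of the lines. -/
def sumDatum (a₀ a₁ : L) (h₀ : IsCMField.complexConj L a₀ = a₀) (h₁ : IsCMField.complexConj L a₁ = a₁)
    (h₀0 : a₀ ≠ 0) (h₁0 : a₁ ≠ 0) (hs : a₀ + a₁ ≠ 0) : SeesawDatum L where
  a := ![a₀, a₁, a₀ + a₁, a₀ * a₁ * (a₀ + a₁)]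
  a_real := by
    intro i
    fin_cases i <;> simp [h₀, h₁]
  a_ne := by
    intro i
    fin_cases i <;> simp [h₀0, h₁0, hs]
  iso := ⟨sumGL a₀ a₁ hs, by
    rw [sumGL_val, sumMat]
    ext i j
    fin_cases i <;> fin_cases j <;> simp [Matrix.mul_apply, Fin.sum_univ_two, diagonal, h₀, h₁] <;> ring⟩

/-- The discriminants of the sum datum. -/
@[simp] theorem sumDatum_a (a₀ a₁ : L) (h₀ : IsCMField.complexConj L a₀ = a₀) (h₁ : IsCMField.complexConj L a₁ = a₁)
    (h₀0 : a₀ ≠ 0) (h₁0 : a₁ ≠ 0) (hs : a₀ + a₁ ≠ 0) :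
    (sumDatum a₀ a₁ h₀ h₁ h₀0 h₁0 hs).a = ![a₀, a₁, a₀ + a₁, a₀ * a₁ * (a₀ + a₁)] := rfl

/-- `−1` is unitary. -/
def negOne : unitary L := ⟨-1, by simp [Unitary.mem_iff]⟩

/-- **The two tori of the sum datum are different**: `g · diag(−1, 1) · g⁻¹` is not diagonal, so the transported torus
`g T g⁻¹` is not the diagonal torus `T`. -/
theorem map_conj_sumGL_ne (a₀ a₁ : L) (h₁0 : a₁ ≠ 0) (hs : a₀ + a₁ ≠ 0) :
    (diagTorus L).map (MulAut.conj (sumGL a₀ a₁ hs)).toMonoidHom ≠ diagTorus L := by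
  intro heq
  set g : GL (Fin 2) L := sumGL a₀ a₁ hs with hg
  set t : GL (Fin 2) L := diagUnit L negOne 1 with ht
  have htT : t ∈ diagTorus L := ⟨(negOne, 1), rfl⟩
  have hk : g * t * g⁻¹ ∈ diagTorus L := by
    rw [← heq]
    exact ⟨t, htT, rfl⟩
  obtain ⟨x, y, hxy⟩ := (mem_diagTorus_iff L _).1 hk
  -- `g t = D g` with `D = diag(x, y)`
  have hgt : g * t * g⁻¹ * g = g * t := inv_mul_cancel_right _ _
  have hmul : (g : Matrix (Fin 2) (Fin 2) L) * (t : Matrix (Fin 2) (Fin 2) L)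
      = diagonal ![(x : L), (y : L)] * (g : Matrix (Fin 2) (Fin 2) L) := by
    calc (g : Matrix (Fin 2) (Fin 2) L) * (t : Matrix (Fin 2) (Fin 2) L)
        = ((g * t : GL (Fin 2) L) : Matrix (Fin 2) (Fin 2) L) := (Units.val_mul _ _).symm
      _ = ((g * t * g⁻¹ * g : GL (Fin 2) L) : Matrix (Fin 2) (Fin 2) L) := by rw [hgt]
      _ = ((g * t * g⁻¹ : GL (Fin 2) L) : Matrix (Fin 2) (Fin 2) L) * (g : Matrix (Fin 2) (Fin 2) L) :=
          Units.val_mul _ _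
      _ = diagonal ![(x : L), (y : L)] * (g : Matrix (Fin 2) (Fin 2) L) := by rw [hxy]
  have h00 := congrFun (congrFun hmul 0) 0
  have h01 := congrFun (congrFun hmul 0) 1
  simp [hg, ht, sumMat, Matrix.mul_apply, diagonal, negOne] at h00 h01
  -- `h00 : -1 = x`, `h01 : a₁ = x * a₁`
  rw [← h00] at h01
  have h2 : (2 : L) * a₁ = 0 := by linear_combination h01
  exact h₁0 ((mul_eq_zero.1 h2).resolve_left two_ne_zero)

end Sum

end MuTableTori

end Summit.Ventures.HodgeRepro

end
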